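import Mathlib
import Literature.Computability.QuantumComplexity.GaussianRank
import Summits.QuantumAdvantage.QuantumAdvantage.Theses.SpinorFlattening
import Summits.QuantumAdvantage.QuantumAdvantage.Theorems.GaussRankTwoCopies.Negative.TightFour
import HarnessLib.Audit

/-!
# Line `borel-fixed-limit-planes` — skeleton for crux `SpinorFlattening.GaussRankTwoCopies` (stmt-QuantumAdvantage-1248)

Crux-plan, round 1 (planner-cruxplan-stmt-QuantumAdvantage-1248-borel-fixed-limit-pl-0, 2026-08-16), from idea card
`Cruxes/GaussRankTwoCopies/Ideas/borel-fixed-limit-planes.md` (ideator 3) and the triage notes `TRIAGE-r1-{1,2,3}.md`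
(pass ×3, "with doubt on reach": 7 of the 12 candidate planes were untreated by the card; the triage's sharpenings —
"import Buczyński–Landsberg Thm 1.11 for the line cases instead of recomputing areoles", "the Borel analysis is the
natural tool for the metric constant c = 1/4" — are recorded in the line card `Lines/borel-fixed-limit-planes.md`).

CRUX (concluded BY NAME by `GaussRankTwoCopies_of` below):
`Summit.QuantumAdvantage.QuantumAdvantage.Theses.SpinorFlattening.GaussRankTwoCopies` — `χ_G(M ⊗ M) ≥ 4`: for all
`a : Fin 3 → ℂ` and all triples `g` of Gaussian states on `2 * 4` qubits, `|M⟩^{⊗2} ≠ Σ aᵢ gᵢ`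
(`Disproof.crux_iff`: definitionally `TwoCopiesBound IsGaussian 3` over `GaussianRank.lean`).

THE LINE (Landsberg–Michałek normal-form principle run on the LIMIT PLANE, card §Lever). Transfer target
C⁺ = `BorderRankFour` (no sequence of 3-term Gaussian combinations converges to `M⊗M`; C⁺ → crux by constant
sequences, PROVED in `GaussRankTwoCopies_of`). If C⁺ failed, compactness of the Grassmannian gives a LIMIT TRISECANT
PLANE `W ∋ M⊗M` (a limit of 3-planes spanned by three independent even Gaussian vectors — `IsLimitTrisecantPlane`,
stub S1); the set of such planes through `M⊗M` is a projective variety stable under the identity component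
`H = Spin(7) × Spin(7)` of the stabiliser, so Borel's fixed point theorem yields one that is stable under the Borel
subalgebra `𝔟_H` (stub S2; `IsBHStable` = stability under every element of an explicit Borel subalgebra of
`so(8)_A ⊕ so(8)_B` that kills `M⊗M` — a sign-robust description of `𝔟_H`, see `borelGens`); because
`Δ₊(16)|_H = 1 ⊕ 7_A ⊕ 7_B ⊕ 7⊗7′ ⊕ 8⊗8′` is multiplicity-free with pairwise distinct highest weights, the
`𝔟_H`-stable even 3-planes through `M⊗M` are EXACTLY TWELVE explicit planes `plane k` spanned by computational-basis /
GHZ-block vectors (stub S3, the census; re-derived in full in the line card, incl. the non-simple-root cases); and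
each of the twelve is NOT a limit trisecant plane (stubs S4–S6, split by the local obstruction: S4 = the three
planes meeting the spinor variety nowhere, S5 = the four planes meeting it in one reduced point, S6 = the five planes
containing a LINE of the spinor variety — the open core, "areole"/BL type (iv)). `borderRankFour_of` is the
kernel-checked reduction S1 → … → S6 → C⁺, `GaussRankTwoCopies_of` adds the transfer.

CONVENTIONS (all objects are explicit vectors of `ℂ^256 = QReg 8 → ℂ` and explicit `256 × 256` matrices):
wires 0–3 = block A, wires 4–7 = block B; `aⱼ = (c_{j,X} + i c_{j,Y})/2` annihilates `|0⟩ⱼ`, `aⱼ† = (c_{j,X} − i c_{j,Y})/2`;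
`m = |0000⟩ + |1111⟩ ∝ |M⟩`, `u = |1100⟩` (highest weight of `7 = m^⊥ ⊂ S₊`), `f u = a₂†a₁ u ∝ |1010⟩`,
`s = |1000⟩` (highest weight of `8 = S₋`), `f₃ s ∝ |1110⟩`; primes = the same on block B. Positive system of
`so(8)`: `tᵢ − tⱼ (i < j)`, `t₀ + tⱼ`, `−(tₖ + tₗ) (1 ≤ k < l)`, whose Borel subalgebra meets `stab(m) = so(7)` in a
Borel subalgebra of `so(7)` (simple roots `t₁−t₂, t₂−t₃, t₀+t₃ ≡ −(t₁+t₂)`).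

REGISTERED STUBS (the only `sorry`s; statements are the `def`s of §2 unfolded one level; `Registered.stub_…` are the
name-keyed aliases used as hypotheses of `GaussRankTwoCopies_of`):
* S1 `stub_limitPlane`        : `LimitPlane`            — ¬C⁺ ⇒ a limit trisecant plane through `M⊗M` (compactness + parity; size M/L).
* S2 `stub_borelFixedPlane`   : `BorelFixedPlane`       — … ⇒ a `𝔟_H`-stable one (Borel fixed point theorem; size XL in Lean).
* S3 `stub_planeCensus`       : `PlaneCensus`           — `𝔟_H`-stable even 3-planes through `M⊗M` are the twelve `plane k` (size L).
* S4 `stub_noPointPlanes`     : `NoPointPlanesExcluded` — planes 0, 3, 4 contain no Gaussian vector, a limit plane does (size M).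
* S5 `stub_onePointPlanes`    : `OnePointPlanesExcluded`— planes 1, 2 (at `uu′`), 5, 6 (at `ss′`): one reduced point, 2nd-order osculation (size L).
* S6 `stub_linePlanes`        : `LinePlanesExcluded`    — planes 7–11 contain a line of the spinor variety (size XL; HARDEST; open on paper
  along this line — true by the border-rank-4 arguments of cards e8-cartan-quotient / border-rank-four).

DISPROOF USED (`Cruxes/GaussRankTwoCopies/Disproof.lean`, cdisprove gen 1 v5, + the LANDED
`Theorems/GaussRankTwoCopies/Negative/TightFour.lean`, imported above so every stub elaborates next to it):
`false_without_gaussianity` / `false_without_linearIndependence` are honoured at S1 (closedness of the Gaussian cone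
needs the full 8-dimensional annihilator) and S4–S6 (local geometry of the spinor variety); `not_twoCopiesBound_four` /
`gaussRankTwoCopies_tight_four` is respected (at four terms the census acquires the honest 4-secant 4-planes through the
Fock corners `½|c⁴d⁴⟩`, which ARE limit planes — the line does not prove too much); `Parity.gaussianRank_not_multiplicative`:
parity of `M` enters at S1 (projection to the even sector). No stub is an instance of a landed Negative lemma. §3's
numerics (residual floor 0.2500, incl. border-type runs) support C⁺.
-/

set_option autoImplicit false
set_option linter.dupNamespace false

noncomputable section

namespace Summit.QuantumAdvantage.QuantumAdvantage.Cruxes.GaussRankTwoCopies.BorelFixedLimitPlanes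

open Literature.Computability.QuantumComplexity Literature.Computability.Cryptography Matrix
open scoped BigOperators

/-! ## §1 Vocabulary -/

/-- The ambient space `Δ(16) = (ℂ²)^{⊗8}` of 8-qubit amplitude vectors. -/
abbrev V : Type := QReg 8 → ℂ

/-- Linear operators on `V` as `256 × 256` matrices. -/
abbrev Op : Type := Matrix (QReg 8) (QReg 8) ℂ

/-- The target `p = |M⟩ ⊗ |M⟩` (amplitude `1/2` on the four block-constant strings). -/
def pt : V := magicMPow 2

/-- Even fermionic parity: no amplitude on odd-weight bit strings. -/
def IsEven {n : ℕ} (ψ : QReg n → ℂ) : Prop :=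
  ∀ x, (Finset.univ.filter fun i => x i = true).card % 2 = 1 → ψ x = 0

/-- An honest (even) TRISECANT FRAME: three linearly independent even Gaussian vectors. -/
def IsTrisecantFrame (e : Fin 3 → V) : Prop :=
  LinearIndependent ℂ e ∧ ∀ i, IsGaussian (e i) ∧ IsEven (e i)

/-- `W` is a LIMIT TRISECANT PLANE: there are trisecant frames `e n` and bases `f n` of their spans converging
(entrywise, i.e. in `ℂ^{3 × 256}`) to a linearly independent even triple `l` spanning `W`. Equivalently: `W` lies in
the closure, in the Grassmannian `Gr(3, Δ₊)`, of the set of honest trisecant planes of the even spinor variety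
(= its Zariski closure, the set being constructible); `⋃ W` over these planes is the cone `σ̂₃`. -/
def IsLimitTrisecantPlane (W : Submodule ℂ V) : Prop :=
  ∃ (e f : ℕ → Fin 3 → V) (l : Fin 3 → V),
    (∀ n, IsTrisecantFrame (e n)) ∧
    (∀ n, Submodule.span ℂ (Set.range (f n)) = Submodule.span ℂ (Set.range (e n))) ∧
    Filter.Tendsto f Filter.atTop (nhds l) ∧
    LinearIndependent ℂ l ∧ (∀ j, IsEven (l j)) ∧
    W = Submodule.span ℂ (Set.range l)

/-- Annihilation operator `aⱼ = (c_{j,X} + i c_{j,Y})/2` (kills `|0⟩ⱼ`; Jordan–Wigner string included). -/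
def ann (j : Fin 8) : Op := (1 / 2 : ℂ) • (majorana 8 j false + Complex.I • majorana 8 j true)

/-- Creation operator `aⱼ† = (c_{j,X} − i c_{j,Y})/2`. -/
def cre (j : Fin 8) : Op := (1 / 2 : ℂ) • (majorana 8 j false - Complex.I • majorana 8 j true)

/-- Cartan generator `c_{j,X} c_{j,Y} = i Zⱼ = i (1 − 2 nⱼ)`. -/
def cartan (j : Fin 8) : Op := majorana 8 j false * majorana 8 j true

/-- Two wires lie in the same block (A = wires 0–3, B = wires 4–7). -/
def SameBlock (i j : Fin 8) : Prop := (i.val < 4 ∧ j.val < 4) ∨ (4 ≤ i.val ∧ 4 ≤ j.val)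

/-- The first wire of a block (wire 0 of A, wire 4 of B). -/
def IsBlockHead (i : Fin 8) : Prop := i.val = 0 ∨ i.val = 4

/-- Generators of the Borel subalgebra `𝔟_A^big ⊕ 𝔟_B^big` of `so(8)_A ⊕ so(8)_B` (spin representation) for the
positive system `{tᵢ − tⱼ (i<j), t₀ + tⱼ, −(tₖ + tₗ) (1 ≤ k < l ≤ 3)}` of each block: the Cartan elements `i Zⱼ`,
the root vectors `aᵢ†aⱼ (i < j)`, `a₀†aⱼ†`, `aₖ aₗ` (block B: wires shifted by 4). Its intersection with the
stabiliser of `M⊗M` is a Borel subalgebra `𝔟_H` of `stab(M⊗M) = so(7)_A ⊕ so(7)_B` (dimension 12 + 12): the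
Cartan differences, all `aᵢ†aⱼ`, and the three combinations `a₀†aⱼ† ± aₖaₗ` (`{j,k,l} = {1,2,3}`) per block —
whatever the signs are, which is why `IsBHStable` quantifies over the span and tests `X p = 0`. -/
def borelGens : Set Op :=
  Set.range cartan ∪
  {X | ∃ i j : Fin 8, SameBlock i j ∧ i < j ∧ X = cre i * ann j} ∪
  {X | ∃ i j : Fin 8, SameBlock i j ∧ i < j ∧ IsBlockHead i ∧ X = cre i * cre j} ∪
  {X | ∃ k l : Fin 8, SameBlock k l ∧ k < l ∧ ¬ IsBlockHead k ∧ X = ann k * ann l}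

/-- The linear span of `borelGens` (a 32-dimensional solvable Lie algebra of operators). -/
def borelSpan : Submodule ℂ Op := Submodule.span ℂ borelGens

/-- `W` is `𝔟_H`-STABLE: stable under every element of `borelSpan` that kills `p = M⊗M`
(`𝔟_H := borelSpan ∩ stab(p)`, a Borel subalgebra of `so(7)_A ⊕ so(7)_B`). -/
def IsBHStable (W : Submodule ℂ V) : Prop :=
  ∀ X ∈ borelSpan, X *ᵥ pt = 0 → ∀ v ∈ W, X *ᵥ v ∈ W

/-- The bit string with `true` exactly on the wires listed in `S`. -/
def bits (S : Finset ℕ) : QReg 8 := fun w => decide (w.val ∈ S)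

/-- The computational basis state `|S⟩` (occupied wires `S`). -/
def ket (S : Finset ℕ) : V := basisState (bits S)

/-- `u ⊗ m′ = |1100⟩ ⊗ (|0000⟩ + |1111⟩)`: highest weight vector of the constituent `7_A`. -/
def um' : V := ket {0, 1} + ket {0, 1, 4, 5, 6, 7}
/-- `m ⊗ u′`: highest weight vector of `7_B`. -/
def mu' : V := ket {4, 5} + ket {0, 1, 2, 3, 4, 5}
/-- `u ⊗ u′ = |1100 1100⟩`: highest weight vector of `7 ⊗ 7′` (a Gaussian vector). -/
def uu' : V := ket {0, 1, 4, 5}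
/-- `s ⊗ s′ = |1000 1000⟩`: highest weight vector of `8 ⊗ 8′` (a Gaussian vector). -/
def ss' : V := ket {0, 4}
/-- `(f_{α₁} u) ⊗ m′`, `f_{α₁} = a₂†a₁`, `f_{α₁} u ∝ |1010⟩`. -/
def fum' : V := ket {0, 2} + ket {0, 2, 4, 5, 6, 7}
/-- `m ⊗ (f_{α₁} u′)`. -/
def mfu' : V := ket {4, 6} + ket {0, 1, 2, 3, 4, 6}
/-- `(f_{α₁} u) ⊗ u′ = |1010 1100⟩`. -/
def fuu' : V := ket {0, 2, 4, 5}
/-- `u ⊗ (f_{α₁} u′) = |1100 1010⟩`. -/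
def ufu' : V := ket {0, 1, 4, 6}
/-- `(f_{α₃} s) ⊗ s′ = |1110 1000⟩`, `f_{α₃} ∝ a₃a₀ ± a₁†a₂†`. -/
def fss' : V := ket {0, 1, 2, 4}
/-- `s ⊗ (f_{α₃} s′) = |1000 1110⟩`. -/
def sfs' : V := ket {0, 4, 5, 6}

/-- The two vectors that, together with `p`, span candidate plane `k` (census order: 0 `⟨p,um′,mu′⟩`,
1 `⟨p,um′,uu′⟩`, 2 `⟨p,mu′,uu′⟩`, 3 `⟨p,um′,fum′⟩`, 4 `⟨p,mu′,mfu′⟩`, 5 `⟨p,um′,ss′⟩`, 6 `⟨p,mu′,ss′⟩`,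
7 `⟨p,uu′,ss′⟩`, 8 `⟨p,uu′,fuu′⟩`, 9 `⟨p,uu′,ufu′⟩`, 10 `⟨p,ss′,fss′⟩`, 11 `⟨p,ss′,sfs′⟩`). -/
def planeVecs : Fin 12 → V × V :=
  ![(um', mu'), (um', uu'), (mu', uu'), (um', fum'), (mu', mfu'), (um', ss'), (mu', ss'),
    (uu', ss'), (uu', fuu'), (uu', ufu'), (ss', fss'), (ss', sfs')]

/-- Candidate plane `k`: the span of `p` and the two vectors `planeVecs k`. -/
def plane (k : Fin 12) : Submodule ℂ V :=
  Submodule.span ℂ {pt, (planeVecs k).1, (planeVecs k).2}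

/-- TRANSFER TARGET C⁺ (verbatim as in `Ideator3Sketch.lean`): BORDER Gaussian rank of `M⊗M` is `≥ 4` — no
sequence of 3-term Gaussian combinations converges to `M⊗M`. Equivalent to `∃ c > 0, Disproof.DistBound 3 c`. -/
def BorderRankFour : Prop :=
  ∀ (a : ℕ → Fin 3 → ℂ) (g : ℕ → Fin 3 → QReg (2 * 4) → ℂ), (∀ n i, IsGaussian (g n i)) →
    ¬ Filter.Tendsto (fun n => ∑ i, a n i • g n i) Filter.atTop (nhds (magicMPow 2))

/-! ## §2 Stub statements -/

/-- **S1 `LimitPlane`** (compactness; size M/L). If some sequence of 3-term Gaussian combinations converges to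
`p`, then `p` lies on a limit trisecant plane. Proof: Gaussian vectors have definite parity (vacuum uniqueness for
the Lagrangian annihilator, `n = 8`), so the even projections `Σ_{gᵢ even} aᵢgᵢ` still converge to `p`; pad / replace
dependent or odd terms by other even Gaussian vectors with coefficient `0` to get independent even frames with the
combination in their span; Gram–Schmidt bases lie in a compact set, extract a convergent subsequence; the limit triple
is orthonormal (independent), even (closed condition), and its span contains `p = lim`. Why it might fail: it does
not (pure compactness); the cost is the parity lemma and the subsequence bookkeeping in Lean. -/
def LimitPlane : Prop :=
  ¬ BorderRankFour → ∃ W : Submodule ℂ V, IsLimitTrisecantPlane W ∧ pt ∈ W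

/-- **S2 `BorelFixedPlane`** (Borel fixed point theorem; size XL in Lean — no algebraic groups in Mathlib).
The set `𝒲_p` of limit trisecant planes through `p` is a Zariski-closed (constructible-closure) subset of
`Gr(3, Δ₊)`, nonempty by hypothesis, and stable under the connected solvable algebraic group `B_H ⊂ GL(Δ₊)`
generated by `exp X`, `X ∈ 𝔟_H = borelSpan ∩ stab(p)` (these are even Clifford-group elements: they fix `p`, map even
Gaussian vectors to even Gaussian vectors and frames to frames, and are continuous); Borel's fixed point theorem
(Borel, *Linear Algebraic Groups* 10.4; Humphreys 21.2) gives a `B_H`-fixed `W ∈ 𝒲_p`, and fixedness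
differentiates to `IsBHStable W`. Elementary route for Lean: torus limits `lim_{t→0} λ(t)·W` in Plücker
coordinates, then `𝔾ₐ`-limits along a composition series of the unipotent radical (the textbook proof unwound).
Why it might fail: it does not mathematically; formalisation weight only. -/
def BorelFixedPlane : Prop :=
  (∃ W : Submodule ℂ V, IsLimitTrisecantPlane W ∧ pt ∈ W) →
    ∃ W : Submodule ℂ V, IsLimitTrisecantPlane W ∧ pt ∈ W ∧ IsBHStable W

/-- **S3 `PlaneCensus`** (highest-weight calculus; size L). A `𝔟_H`-stable EVEN 3-plane through `p` is one of
the twelve `plane k`. Proof (line card §Census, complete): `𝔟_H ⊇` Cartan differences + all positive root vectors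
of `B₃ × B₃`; `W` is a sum of weight spaces; Lie's theorem on `W/ℂp ⊂ Δ₊/ℂp ≅ 7_A ⊕ 7_B ⊕ 7⊗7′ ⊕ 8⊗8′`
(multiplicity-free, highest weights `ε₁^A, ε₁^B, ε₁^A+ε₁^B, ω₃^A+ω₃^B` pairwise distinct) puts a highest weight
vector `hw_c ∈ W`; the third weight vector `w′` of `W` satisfies `e_α w′ ∈ ℂ hw_c` for all positive `α`, which
forces `w′ ∈ ℂ hw_{c′}` (6 planes) or `w′ ∈ ℂ f_α hw_c` with `α = α₁` on a `7`-factor / `α = α₃` on an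
`8`-factor (6 planes) — checked weight by weight in `7` (weights `±εᵢ, 0`) and in the minuscule `8`, including the
non-simple positive roots. Why it might fail: a convention slip in the explicit vectors (guarded by the exact check
`compute/borel_census_check.py` of this line: `dim 𝔟_H = 24`, joint kernel of the positive root vectors on `Δ₊` =
`span{p, um′, mu′, uu′, ss′}`, the lowerings, and `𝔟_H`-stability of all twelve planes). -/
def PlaneCensus : Prop :=
  ∀ l : Fin 3 → V, LinearIndependent ℂ l → (∀ j, IsEven (l j)) →
    pt ∈ Submodule.span ℂ (Set.range l) → IsBHStable (Submodule.span ℂ (Set.range l)) →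
      ∃ k : Fin 12, Submodule.span ℂ (Set.range l) = plane k

/-- **S4 `NoPointPlanesExcluded`** (size M). Planes 0 `⟨p, um′, mu′⟩`, 3 `⟨p, um′, fum′⟩`, 4 `⟨p, mu′, mfu′⟩` are
not limit trisecant planes: (a) a limit trisecant plane contains a (nonzero) Gaussian vector — normalise the frame
vectors, extract a convergent subsequence, the limit is Gaussian (annihilator Lagrangians converge in `OG(8,16)`,
compact) and lies in `W` (coefficients w.r.t. the converging bases stay bounded); (b) these three planes contain
none: their vectors are `v ⊗ m′ (+ γ m ⊗ u′)` with odd⊗odd block `0`, and an even Gaussian vector with vanishing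
odd⊗odd block is a product `e ⊗ e′` of PURE 4-mode spinors (`ProductFactorsGaussian`), while `m, m′` are not pure
and `q(βm′ + γu′) = β² q(m′)`. Why it might fail: it does not (card exclusions (1)–(3), triage-checked). -/
def NoPointPlanesExcluded : Prop :=
  ∀ k : Fin 12, (k.val = 0 ∨ k.val = 3 ∨ k.val = 4) → ¬ IsLimitTrisecantPlane (plane k)

/-- **S5 `OnePointPlanesExcluded`** (second-order osculation; size L). Planes 1 `⟨p, um′, uu′⟩`, 2 `⟨p, mu′, uu′⟩`
meet the Gaussian cone exactly in `ℂ uu′`, planes 5 `⟨p, um′, ss′⟩`, 6 `⟨p, mu′, ss′⟩` exactly in `ℂ ss′` (cut-type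
analysis: a type-1 Gaussian has pure⊗pure even block). A limit of trisecant planes all three of whose points tend to
one point `[g]` is `⟨g, τ, II(τ,τ) + τ′⟩` with `τ, τ′ ∈ T̂_g` (curvilinear) or lies in `T̂_g` (planar); for planes 1, 2
the card computes `II(um′, um′) ≡ u ⊗ γ″` with `q(u′, γ″) = −q(m′) ≠ 0`, not in `ℂ p + T̂_{uu′}`, and `p ∉ T̂_{uu′}`
kills the planar case; planes 5, 6 need the same computation at `ss′` (here `um′ = a₀†a₁† p`-type vectors are
tangent to the ORBIT of `p`, cf. ideator 2's `borel_planes.out`, so only second-order data can decide). Why it might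
fail: planes 5, 6 are not done by hand (true by border rank 4: cards e8-cartan-quotient, border-rank-four). -/
def OnePointPlanesExcluded : Prop :=
  ∀ k : Fin 12, (k.val = 1 ∨ k.val = 2 ∨ k.val = 5 ∨ k.val = 6) → ¬ IsLimitTrisecantPlane (plane k)

/-- **S6 `LinePlanesExcluded`** — THE HARDEST STUB (size XL; the open core of this line). Planes 7 `⟨p, uu′, ss′⟩`,
8 `⟨p, uu′, fuu′⟩`, 9 `⟨p, uu′, ufu′⟩`, 10 `⟨p, ss′, fss′⟩`, 11 `⟨p, ss′, sfs′⟩` each contain a projective LINE of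
the spinor variety (`β uu′ + γ ss′`, `β u + γ f u`, `β s + γ f₃ s` are Gaussian for all `β, γ`: BCS pair / isotropic
2-planes), so point- and first-order tests are empty; needed is the AREOLE of the spinor variety `𝕊₈⁺ ⊂ P(Δ₊)` along
an isotropic line `ℓ` — limits of trisecant planes containing `ℓ` are `⟨ℓ̂, w⟩` with `w` in the span of the
osculating data at points of `ℓ` — equivalently Buczyński–Landsberg's type (iv) `x′ + y′` (arXiv:1111.7005 Thm 1.11,
`𝕊₈` cominuscule) refined to `𝔟_H`-stable configurations: show `p ∉ T̂_x 𝕊 + T̂_y 𝕊` for `x ≠ y ∈ ℓ` and the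
higher (II/III, Landsberg–Manivel 2003 §§2–3) layers; the first-order layer already fails (`T̂`-directions at
points of `ℓ` inside `S₊⊗S₊` are `U_A ⊗ u′ + u ⊗ U_B` with `U` Lagrangian `∌ m`). Why it might fail: as a LOCAL
computation it is undone; globally it is implied by border rank 4 (two independent paper proofs on the item, both
triage-verified), so the statement is true — the risk is cost, not truth. -/
def LinePlanesExcluded : Prop :=
  ∀ k : Fin 12, 7 ≤ k.val → ¬ IsLimitTrisecantPlane (plane k)

/-! ## §3 Registered stubs (the only `sorry`s of the file; statements = §2 unfolded one level) -/

/-- Registered stub S1 (statement = `LimitPlane`). -/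
theorem stub_limitPlane :
    ¬ BorderRankFour → ∃ W : Submodule ℂ V, IsLimitTrisecantPlane W ∧ pt ∈ W := by
  sorry

/-- Registered stub S2 (statement = `BorelFixedPlane`). -/
theorem stub_borelFixedPlane :
    (∃ W : Submodule ℂ V, IsLimitTrisecantPlane W ∧ pt ∈ W) →
      ∃ W : Submodule ℂ V, IsLimitTrisecantPlane W ∧ pt ∈ W ∧ IsBHStable W := by
  sorry

/-- Registered stub S3 (statement = `PlaneCensus`). -/
theorem stub_planeCensus :
    ∀ l : Fin 3 → V, LinearIndependent ℂ l → (∀ j, IsEven (l j)) →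
      pt ∈ Submodule.span ℂ (Set.range l) → IsBHStable (Submodule.span ℂ (Set.range l)) →
        ∃ k : Fin 12, Submodule.span ℂ (Set.range l) = plane k := by
  sorry

/-- Registered stub S4 (statement = `NoPointPlanesExcluded`). -/
theorem stub_noPointPlanes :
    ∀ k : Fin 12, (k.val = 0 ∨ k.val = 3 ∨ k.val = 4) → ¬ IsLimitTrisecantPlane (plane k) := by
  sorry

/-- Registered stub S5 (statement = `OnePointPlanesExcluded`). -/
theorem stub_onePointPlanes :
    ∀ k : Fin 12, (k.val = 1 ∨ k.val = 2 ∨ k.val = 5 ∨ k.val = 6) → ¬ IsLimitTrisecantPlane (plane k) := by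
  sorry

/-- Registered stub S6 (statement = `LinePlanesExcluded`). -/
theorem stub_linePlanes :
    ∀ k : Fin 12, 7 ≤ k.val → ¬ IsLimitTrisecantPlane (plane k) := by
  sorry

/-! ### Registered-stub aliases
`Registered.stub_X` is stub `X`'s statement under the registered stub's short name, so that the native skeleton
audit (`#h21_check_skeleton … stub_…`, run by `ledger skeleton check`) accepts the hypotheses of
`GaussRankTwoCopies_of` as the registered obligations (hypothesis heads are matched by name). -/
namespace Registered

/-- Statement of registered stub S1. -/
abbrev stub_limitPlane : Prop := LimitPlane
/-- Statement of registered stub S2. -/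
abbrev stub_borelFixedPlane : Prop := BorelFixedPlane
/-- Statement of registered stub S3. -/
abbrev stub_planeCensus : Prop := PlaneCensus
/-- Statement of registered stub S4. -/
abbrev stub_noPointPlanes : Prop := NoPointPlanesExcluded
/-- Statement of registered stub S5. -/
abbrev stub_onePointPlanes : Prop := OnePointPlanesExcluded
/-- Statement of registered stub S6. -/
abbrev stub_linePlanes : Prop := LinePlanesExcluded

end Registered

/-! ## §4 Composition (real proofs, no `sorry` below this line) -/

/-- **Reduction.** S1–S6 prove the transfer target C⁺ = `BorderRankFour`: a convergent sequence gives a limit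
trisecant plane through `p` (S1), hence a `𝔟_H`-stable one (S2), which is one of the twelve candidate planes (S3),
none of which is a limit trisecant plane (S4–S6). -/
theorem borderRankFour_of (h₁ : LimitPlane) (h₂ : BorelFixedPlane) (h₃ : PlaneCensus)
    (h₄ : NoPointPlanesExcluded) (h₅ : OnePointPlanesExcluded) (h₆ : LinePlanesExcluded) :
    BorderRankFour := by
  by_contra hnb
  obtain ⟨W, hW, hpW⟩ := h₁ hnb
  obtain ⟨W', hW', hpW', hB⟩ := h₂ ⟨W, hW, hpW⟩
  obtain ⟨e, f, l, he, hspan, hlim, hli, heven, hWeq⟩ := hW'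
  subst hWeq
  obtain ⟨k, hk⟩ := h₃ l hli heven hpW' hB
  have hplane : IsLimitTrisecantPlane (plane k) :=
    ⟨e, f, l, he, hspan, hlim, hli, heven, hk.symm⟩
  have hk12 : k.val < 12 := k.isLt
  by_cases h7 : 7 ≤ k.val
  · exact h₆ k h7 hplane
  · by_cases h034 : k.val = 0 ∨ k.val = 3 ∨ k.val = 4
    · exact h₄ k h034 hplane
    · exact h₅ k (by omega) hplane

/-- **Composition (the skeleton theorem).** The crux `GaussRankTwoCopies`, concluded BY NAME, from the six
registered stubs: `borderRankFour_of` gives C⁺, and C⁺ implies the crux via constant sequences (the Transfer of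
the idea card, kernel-checked here as in `Ideator3Sketch.borderRankFour_imp_crux`). -/
theorem GaussRankTwoCopies_of (h₁ : Registered.stub_limitPlane) (h₂ : Registered.stub_borelFixedPlane)
    (h₃ : Registered.stub_planeCensus) (h₄ : Registered.stub_noPointPlanes)
    (h₅ : Registered.stub_onePointPlanes) (h₆ : Registered.stub_linePlanes) :
    Summit.QuantumAdvantage.QuantumAdvantage.Theses.SpinorFlattening.GaussRankTwoCopies := by
  have hb : BorderRankFour := borderRankFour_of h₁ h₂ h₃ h₄ h₅ h₆
  intro a g hg heq
  refine hb (fun _ => a) (fun _ => g) (fun _ i => ?_) ?_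
  · exact hg i
  · have : (fun _ : ℕ => ∑ i, a i • g i) = fun _ => magicMPow 2 := by
      funext n; exact heq.symm
    rw [this]
    exact tendsto_const_nhds

/-- How the closed proof is obtained once the six stubs land (an `example`, so that `GaussRankTwoCopies_of` is
the only theorem of this file concluding the crux; it also checks that each registered stub's unfolded statement
is definitionally its §2 `def`). -/
example : Summit.QuantumAdvantage.QuantumAdvantage.Theses.SpinorFlattening.GaussRankTwoCopies :=
  GaussRankTwoCopies_of stub_limitPlane stub_borelFixedPlane stub_planeCensus stub_noPointPlanes
    stub_onePointPlanes stub_linePlanes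

end Summit.QuantumAdvantage.QuantumAdvantage.Cruxes.GaussRankTwoCopies.BorelFixedLimitPlanes

end
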